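import Summits.AtomisticToContinuum.BoseEinsteinCondensation.Theses.BECInsertionCorrector
import Summits.AtomisticToContinuum.BoseEinsteinCondensation.Theorems.CorrectorClosure.Negative.InsertionResidueLoadBearing
import Summits.AtomisticToContinuum.BoseEinsteinCondensation.Theorems.CorrectorClosure.Negative.InsertionResidueTorusPlaneWaves
import Literature.MathematicalPhysics.QuantumManyBody.PeriodicBoseGasCouplingPath

/-!
# Negative lemmas for the stubs of line `llp-fidelity-arc` (crux `CorrectorClosure`,
stmt-AtomisticToContinuum-12058): the undressed anchor

`stub_undressedSpeed` of `Cruxes/CorrectorClosure/Lines/llp-fidelity-arc.lean` (v2) concludes, from K1, the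
UNDRESSED ANCHOR of a potential `v`: the local Fubini–Study speed bound of the coupled near-minimiser path at the
decoupled end `λ = 0`. Two load-bearing analyses (drefute seat, 2026-08-16):

* `undressedAnchor_constOne_false` / `undressedSpeedWithoutFiniteRange_iff` — FINITE RANGE IS LOAD-BEARING for the
  anchor: for the measurable, repulsive, NOT finite-range `v ≡ 1` every coupled energy with `N ≥ 2` bath particles is
  `⊤` (`coupledEnergy_constOne_eq_top`), so every tagged state is a near-minimiser at every coupling, while the
  constant state and a boosted condensate are Fubini–Study orthogonal (`fsAngle_const_planeWave`); hence the stub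
  with `IsRepulsiveFiniteRange v` weakened to `Measurable v` is equivalent to `¬ StaticResponseBound`. Any proof of
  `stub_undressedSpeed` must use finiteness of the BATH energy `E₀^per(N, L_N) < ⊤` (Ruelle at `N` particles in the
  `(N+1)`-box), not only the `(N+1)`-body finiteness used by the glue.
* `undressedAnchorWithoutWindow_zero_false` — THE WINDOW ON `Ψ'` IS LOAD-BEARING already at `v = 0`: the constant
  state is an exact minimiser at `λ = 0` (`coupledEnergy_zero_const`) and the boosted condensate is an admissible
  `Ψ'` at angle `π/2`.
-/

noncomputable section

open MeasureTheory Filter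
open scoped ENNReal NNReal ComplexConjugate BigOperators

namespace Summit.AtomisticToContinuum.BoseEinsteinCondensation.Theorems.CorrectorClosure.Negative

open Literature.MathematicalPhysics.QuantumManyBody.BoseGas
open Summit.AtomisticToContinuum.BoseEinsteinCondensation.Theses.BECInsertionCorrector

variable {N : ℕ} {L : ℝ}

/-! ## The constant potential `v ≡ 1`: every coupled energy is `⊤` once `N ≥ 2` -/

/-- For `v ≡ 1` and at least two bath particles, every coupled tagged energy is `⊤` (the bath–bath
term alone is `∑_{ℤ³} 1 · |Ψ|²`). [folklore] -/
theorem coupledEnergy_constOne_eq_top (hN : 2 ≤ N) (lam : ℝ) (Ψ : TaggedPeriodicTrialState N L) :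
    coupledEnergy (fun _ => 1) lam Ψ = ⊤ := by
  have hmeas : Measurable fun X : Config (N + 1) => (‖Ψ.ψ X‖₊ : ℝ≥0∞) ^ 2 :=
    (Ψ.contDiff.continuous.measurable.nnnorm.coe_nnreal_ennreal.pow_const 2)
  refine top_le_iff.1 ?_
  calc (⊤ : ℝ≥0∞) = ⊤ * ∫⁻ X in cellN (N + 1) L, (‖Ψ.ψ X‖₊ : ℝ≥0∞) ^ 2 := by
        rw [Ψ.norm_eq, mul_one]
    _ = ∫⁻ X in cellN (N + 1) L, ⊤ * (‖Ψ.ψ X‖₊ : ℝ≥0∞) ^ 2 := (lintegral_const_mul ⊤ hmeas).symm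
    _ ≤ coupledEnergy (fun _ => 1) lam Ψ := by
        unfold coupledEnergy
        refine lintegral_mono fun X => ?_
        rw [periodicInteraction_one hN L (Matrix.vecTail X), add_top]
        exact le_add_self

/-- Hence the coupled ground-state energy is `⊤` at every coupling. [folklore] -/
theorem coupledGroundStateEnergy_constOne_eq_top (hN : 2 ≤ N) (lam : ℝ) (L : ℝ) :
    coupledGroundStateEnergy (fun _ => 1) lam N L = ⊤ := by
  unfold coupledGroundStateEnergy
  exact iInf_eq_top.2 fun Ψ => coupledEnergy_constOne_eq_top hN lam Ψ

/-! ## Two Fubini–Study orthogonal tagged states: the constant and a boosted condensate -/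

/-- `⟨const, boosted condensate⟩ = 0` on the tagged cell (`k ≠ 0`). [folklore] -/
theorem taggedInner_const_planeWave (N : ℕ) (hL : 0 < L) {k : Fin 3 → ℤ} (hk : k ≠ 0) :
    taggedInner (TaggedPeriodicTrialState.const N hL) (planeWave (N + 1) hL k).toTagged = 0 := by
  unfold taggedInner
  have h : ∀ X : Config (N + 1),
      conj ((TaggedPeriodicTrialState.const N hL).ψ X) * (planeWave (N + 1) hL k).toTagged.ψ X =
        (conj (((Real.sqrt (L ^ 3))⁻¹ : ℂ) ^ (N + 1)) * (normConst (N + 1) L : ℂ)) *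
          ∏ j, pw L k (X j) := by
    intro X
    rw [PeriodicTrialState.toTagged_ψ, planeWave_ψ]
    simp only [TaggedPeriodicTrialState.const]
    ring
  simp_rw [h]
  rw [integral_const_mul, setIntegral_cellN_prod L (fun _ x => pw L k x)]
  obtain ⟨j⟩ : Nonempty (Fin (N + 1)) := ⟨0⟩
  rw [Finset.prod_eq_zero (Finset.mem_univ (0 : Fin (N + 1))) (setIntegral_cell_pw hL hk), mul_zero]

/-- Hence the two rays are at Fubini–Study angle `π/2`. [folklore] -/
theorem fsAngle_const_planeWave (N : ℕ) (hL : 0 < L) {k : Fin 3 → ℤ} (hk : k ≠ 0) :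
    fsAngle (TaggedPeriodicTrialState.const N hL) (planeWave (N + 1) hL k).toTagged = Real.pi / 2 := by
  rw [fsAngle, taggedInner_const_planeWave N hL hk, norm_zero, Real.arccos_zero]

/-! ## Finite range is load-bearing for the undressed anchor -/

/-- The undressed anchor of a potential `v` (conclusion shape of `stub_undressedSpeed`, v2 skeleton,
verbatim). -/
def UndressedAnchorOf (v : ℝ → ℝ≥0∞) : Prop :=
  ∀ θ : ℝ, 0 < θ → ∃ ρ₀ : ℝ, 0 < ρ₀ ∧ ∀ ρ : ℝ, 0 < ρ → ρ < ρ₀ → ∀ᶠ N : ℕ in atTop,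
    ∃ η : ℝ, 0 < η ∧ ∀ lam' ∈ Set.Icc (0 : ℝ) 1, lam' ≠ 0 → |lam' - 0| < η →
      ∃ δ : ℝ≥0∞, 0 < δ ∧ ∀ Ψ Ψ' : TaggedPeriodicTrialState N (sideLength ρ (N + 1)),
        coupledEnergy v 0 Ψ ≤ coupledGroundStateEnergy v 0 N (sideLength ρ (N + 1)) + δ →
        coupledEnergy v lam' Ψ' ≤ coupledGroundStateEnergy v lam' N (sideLength ρ (N + 1)) + δ →
          fsAngle Ψ Ψ' ≤ ∫ t in Set.uIcc 0 lam', (fun _ : ℝ => θ) t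

/-- `stub_undressedSpeed` with `IsRepulsiveFiniteRange v` weakened to `Measurable v`. -/
def UndressedSpeedWithoutFiniteRange : Prop :=
  StaticResponseBound → ∀ v : ℝ → ℝ≥0∞, Measurable v → UndressedAnchorOf v

/-- The constant majorant integrates to `θ |λ'|`. [folklore] -/
theorem integral_const_uIcc_zero (lam' θ : ℝ) :
    ∫ _ in Set.uIcc (0 : ℝ) lam', θ = θ * |lam'| := by
  rw [setIntegral_const, smul_eq_mul, Measure.real, Real.volume_interval,
    ENNReal.toReal_ofReal (abs_nonneg _), sub_zero, mul_comm]

/-- **The anchor fails for `v ≡ 1`** (measurable, repulsive, infinite range): at slope `θ = 1`, for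
every density and every `N ≥ 2`, all states are near-minimisers and the constant state is orthogonal
to the boosted condensate, at angle `π/2 > λ'`. [folklore] -/
theorem undressedAnchor_constOne_false : ¬ UndressedAnchorOf (fun _ => 1) := by
  intro h
  obtain ⟨ρ₀, hρ₀, h⟩ := h 1 one_pos
  obtain ⟨N, ⟨η, hη, h⟩, hN2⟩ :=
    ((h (ρ₀ / 2) (by positivity) (by linarith)).and (Filter.eventually_ge_atTop 2)).exists
  set lam' : ℝ := min (η / 2) (1 / 2) with hlam'
  have hlam'pos : 0 < lam' := lt_min (by positivity) (by norm_num)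
  have hlam'le : lam' ≤ 1 / 2 := min_le_right _ _
  have hlam'lt : |lam' - 0| < η := by
    rw [sub_zero, abs_of_pos hlam'pos]
    exact (min_le_left _ _).trans_lt (by linarith)
  obtain ⟨δ, _hδ, h⟩ := h lam' ⟨hlam'pos.le, by linarith⟩ hlam'pos.ne' hlam'lt
  have hL := sideLength_succ_pos (show (0 : ℝ) < ρ₀ / 2 by positivity) N
  have key := h (TaggedPeriodicTrialState.const N hL) (planeWave (N + 1) hL e0).toTagged
    (by rw [coupledGroundStateEnergy_constOne_eq_top hN2]; exact le_top)
    (by rw [coupledGroundStateEnergy_constOne_eq_top hN2]; exact le_top)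
  rw [fsAngle_const_planeWave N hL e0_ne_zero, integral_const_uIcc_zero, one_mul,
    abs_of_pos hlam'pos] at key
  linarith [Real.pi_gt_three]

/-- **Finite range is load-bearing for `stub_undressedSpeed`**: with `Measurable v` in place of
`IsRepulsiveFiniteRange v` the statement holds iff K1 fails. [folklore] -/
theorem undressedSpeedWithoutFiniteRange_iff :
    UndressedSpeedWithoutFiniteRange ↔ ¬ StaticResponseBound :=
  ⟨fun h hK => undressedAnchor_constOne_false (h hK _ measurable_const), fun h hK => (h hK).elim⟩

/-! ## The window on `Ψ'` is load-bearing for the anchor, already at `v = 0` -/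

/-- The constant tagged state has zero coupled energy for the free gas `v = 0` (at any coupling:
`u_λ = min(0, h) = 0`). [folklore] -/
theorem coupledEnergy_zero_const (lam : ℝ) (hL : 0 < L) :
    coupledEnergy (0 : ℝ → ℝ≥0∞) lam (TaggedPeriodicTrialState.const N hL) = 0 := by
  unfold coupledEnergy
  have hkin : ∀ X : Config (N + 1),
      taggedKineticDensity 1 (TaggedPeriodicTrialState.const N hL).ψ X = 0 := by
    intro X
    have hc : (TaggedPeriodicTrialState.const N hL).ψ =
        fun _ => (((Real.sqrt (L ^ 3))⁻¹ : ℂ) ^ (N + 1)) := rfl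
    simp [taggedKineticDensity, hc]
  have hprof : couplingProfile (0 : ℝ → ℝ≥0∞) lam = 0 := by
    funext r; simp [couplingProfile]
  have hint : ∀ Y : Config N, periodicInteraction (0 : ℝ → ℝ≥0∞) L Y = 0 := by
    intro Y; simp [periodicInteraction, periodizedPotential]
  simp_rw [hkin, hprof, impurityInteraction_zero, hint, zero_add, zero_mul]
  exact lintegral_zero

/-- The anchor with the near-minimiser window on `Ψ'` DROPPED (that on `Ψ` kept). -/
def UndressedAnchorWithoutWindow (v : ℝ → ℝ≥0∞) : Prop :=
  ∀ θ : ℝ, 0 < θ → ∃ ρ₀ : ℝ, 0 < ρ₀ ∧ ∀ ρ : ℝ, 0 < ρ → ρ < ρ₀ → ∀ᶠ N : ℕ in atTop,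
    ∃ η : ℝ, 0 < η ∧ ∀ lam' ∈ Set.Icc (0 : ℝ) 1, lam' ≠ 0 → |lam' - 0| < η →
      ∃ δ : ℝ≥0∞, 0 < δ ∧ ∀ Ψ Ψ' : TaggedPeriodicTrialState N (sideLength ρ (N + 1)),
        coupledEnergy v 0 Ψ ≤ coupledGroundStateEnergy v 0 N (sideLength ρ (N + 1)) + δ →
          fsAngle Ψ Ψ' ≤ ∫ t in Set.uIcc 0 lam', (fun _ : ℝ => θ) t

/-- **The window on `Ψ'` is load-bearing**, already for the free gas `v = 0` (admissible): the
constant state is an exact minimiser at `λ = 0` and the boosted condensate is at angle `π/2`.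
[folklore] -/
theorem undressedAnchorWithoutWindow_zero_false : ¬ UndressedAnchorWithoutWindow 0 := by
  intro h
  obtain ⟨ρ₀, hρ₀, h⟩ := h 1 one_pos
  obtain ⟨N, η, hη, h⟩ := (h (ρ₀ / 2) (by positivity) (by linarith)).exists
  set lam' : ℝ := min (η / 2) (1 / 2) with hlam'
  have hlam'pos : 0 < lam' := lt_min (by positivity) (by norm_num)
  have hlam'le : lam' ≤ 1 / 2 := min_le_right _ _
  have hlam'lt : |lam' - 0| < η := by
    rw [sub_zero, abs_of_pos hlam'pos]
    exact (min_le_left _ _).trans_lt (by linarith)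
  obtain ⟨δ, _hδ, h⟩ := h lam' ⟨hlam'pos.le, by linarith⟩ hlam'pos.ne' hlam'lt
  have hL := sideLength_succ_pos (show (0 : ℝ) < ρ₀ / 2 by positivity) N
  have key := h (TaggedPeriodicTrialState.const N hL) (planeWave (N + 1) hL e0).toTagged
    (by rw [coupledEnergy_zero_const 0 hL]; exact zero_le)
  rw [fsAngle_const_planeWave N hL e0_ne_zero, integral_const_uIcc_zero, one_mul,
    abs_of_pos hlam'pos] at key
  linarith [Real.pi_gt_three]

end Summit.AtomisticToContinuum.BoseEinsteinCondensation.Theorems.CorrectorClosure.Negative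

end
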